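/- Copyright: the b2b-balaban cell (near-miss cell 7), T⁴-continuum fan-out, row-NE7b OWNER lineage `t4-ne7b-p1` (gen 102) —
(α)-instance, THE END AT THE TOWER, ROUNDED, PER-STEP SHAPE ON THE PERFORMED RANGE, BOTH RUNS FROM ONE TOWER FAMILY, part 1 of 2:
the record.  Released under the licence of the surrounding project. -/
import Summits.QuantumFields.BalabanUV.T4Continuum.Support.B16HistoryTowerEndLWRP82
import Summits.QuantumFields.BalabanUV.T4Continuum.Support.B16HistoryTowerEndPrintedRRange

/-!
# (α)-INSTANCE — THE END AT THE TOWER, ROUNDED, PER-STEP SHAPE ON THE PERFORMED RANGE, BOTH RUNS FROM ONE TOWER FAMILY, part 1: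
`TowerStepRangeDataLWR` = IR-101-2's `TowerStepDataLWR` (= 1R `TowerReadDataLWR` p347096 in print's per-step shape) WITH (Δ1) PRINT's
PER-STEP SENTENCES ASKED ONLY AT THE STEPS THE RUN PERFORMS (`j < K`; 3R-range p349246) AND (Δ2) RUN B READ AS THE SAME TOWER FAMILY AT
CUTOFF `K + 1` (its operations, density, «(1.72) holds», integrability and H2 identity become THEOREMS of the family)

Summits-side support leaf of the T⁴-continuum cell (rung (B)+1 on a FINITE torus only; NOT infinite volume, NOT the mass gap, NOT
Clay; NOT a proof of NE7b — the cell's OWN estimate `T4WeightBudget.RelWeightBound`, NOT PRINTED, NOT PROVED).  [folklore] ONE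
`structure` (a hypothesis SHAPE: data + located displays + C-side letters, NOTHING of Bałaban's asserted); no `[cite:]` tag, no `Prop`
minted, zero `sorry`.  INTERFACE REQUEST NE7b IR-102-2 (OWNER g102, RULING W-ne7bp1-g102-2 upholding the refuter's π-ne7bref-g58-2,
PRICING-NE7b v57 144ddef7ebbc19ae); part 2 (`B16HistoryTowerStepRangeLWRP82`) carries `toTowerR` and the terminal theorem.  IR-101-2's
`TowerStepDataLWR` (all-`j` displays, run B over its own skeleton) stays as the general sibling; 1R ∕ 2R ∕ 3R-range consumed BY NAME.
WHY (Δ1).  A cutoff-`K` run performs the steps `j < K` only; past the cutoff the tower's step maps are PADDING, and asking print's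
sentences ∕ the class junction ∕ the volume chain at EVERY `j` asks the (A1c) instance for displays about operations the run never
performs (π-ne7bref-g58-2; precedent leaf-06 g134 opt-2: the all-`j` preservation display of `Tower.integral_dens_eq` is UNSATISFIABLE
for the natural padding `branch K g = ∅` — folded as `integral_dens_eq_of_lt`).  J4.2 (p347669) + 3R-range
(`hw_of_stepDisplays_rounded_cubeCount_range`, p349246) deliver 1R's `hw` from the RANGE form: (β) `hβ` («past the cutoff the step
maps kill the unit» — the natural padding), `hℓ1`, `hdisp` ∕ `hclass` on `j < K`, p. 380's chain as its two printed links `hΩ`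
(region ⊆ large-field volume) and `hcube` (cube count), constants rows `0 ≤ C′`, `0 ≤ C380`, `C′ + C380 ≤ cΛ`.  Carried here verbatim.
WHY (Δ2).  The uniqueness spine compares the cutoff-`K` run (run A, `K` steps) with the cutoff-`(K+1)` run (run B) of ONE tuned family
([Balaban1988Convergent] (0.1) ∕ Thm 1 — the same recursion started one scale finer; LOCATOR).  In tower form run B IS the family's
tower `T (K+1)` from `ρ₀ (K+1) t`: operations `reprFam … (K+1) t`, final density `densFam … (K+1) t`, «(1.72) holds» = `holdsFam …
(K+1)` (IR-97-2), integrability = `intA (K+1)`, H2 = `H2A (K+1)` (`K₀ ≤ K ⇒ K₀ ≤ K+1`).  So 1R's run-B parameters `I′ Y νB 𝒢′` and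
fields `RB ρB holdsB intB H2B` are REDUNDANT for a tower family: dropped here; the truncation ∕ TRUNC rows ∕ (ρ′) ∕ NE7c shell ∕ NE7
budget are typed at `I′ := skelFam T p₀`, `Y K := X K K`, `νB := μ`, `𝒢′ K := 𝒢 K K`, `RB := reprFam T p₀ ρ₀ hρ₀ h0 B hB`.  What stays
DISPLAYED of run B: `trunc` ∕ `htr` (node O's synchronisation of the two towers' histories), `upB`, `deadB_nonneg`, (ρ′) `resumB`,
their letters and budgets — readings of the SAME family's cutoff-`(K+1)` terms at run A's keys.
DRESSING SLOTS (pointer; no change): `ρ₀ hρ₀ h0 B hB hBρ hBA intA H2A` kept verbatim; an instance fills them BY NAME from ONE-STEP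
displays with the owner's IR-102-1 `B16HistoryTowerEndDressing` (`dress…`, `Bdress…`, `intA_bddMeas`, `H2A_of_stepIdentity`).
WHAT.  `TowerStepDataLWR` FIELD FOR FIELD (generated from leaf-03 g126's staged bytes f6b0619912a887c1, themselves from the tree's 1R
b72521ca9b80d176) with: (Δ1) `hdisp ∕ hclass ∕ hchain` ↦ `hC′ hC380 hcΛc hℓ1 hβ hdisp hclass hΩ hcube` in 3R-range's binder shapes
(`hcΛ` kept — the pinned bundle's slot); (Δ2) parameters `I′ Y νB 𝒢′` and fields `RB ρB holdsB intB H2B` REMOVED, `trunc ∕ htr ∕ dB`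
retyped, `I′ ↦ skelFam T p₀`, `νB ↦ μ`, `RB ↦ reprFam …` SUBSTITUTED in `upB`, `deadB_nonneg`, `resumB`, `shell`, `budget`; all else
verbatim.  HONEST SCOPE: HYPOTHESES over an ABSTRACT tower family; nothing discharged; (A1c) = which tower ∕ carriers ∕ truncation are
Bałaban's stays displayed; ρ UNVALUED; NEEDS-CONSTANT 0; NE7b NOT proved; spine 0∕9.  HONEST DEPENDENCY (cell): continuum YM on T⁴ ⇐
BetaPertH ∧ nine spine estimates (0/9 proved); BetaPertH ⇐ (D1) ∧ (D4) ∧ CAP+tail; G-an2-4 gates asym, D1 and NE2/3/4.  Unchanged.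
-/
open Finset MeasureTheory
open Literature.MathematicalPhysics.QuantumFieldTheory.Balaban1983to89
open T4PersistenceDictionary T4PersistentHistoryCount T4BankedInduction T4PrintedShapeBanking
open T4WeightBudget T4GlobalDenominator T4LiveClassFibration T4LiveStructureGas T4LiveGasToTerms T4RecordPriceSeam
open T4PartnerMultiplicity T4IndicatorShell T4MatchingAssembly T4MatchingClosure T4MatchingClosureSocket T4Continuum
open T4StabilitySocket T4BranchingRecordsGas T4TaggedShapeBanking T4CanonicalMenus T4RenewalChains
open Summit.QuantumFields.BalabanUV.T4Continuum.PlacementBatch Summit.QuantumFields.BalabanUV.T4Continuum.PlacementSkeleton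
open Summit.QuantumFields.BalabanUV.T4Continuum.CountThresholdUniform Summit.QuantumFields.BalabanUV.T4Continuum.CountThresholdExit
open Summit.QuantumFields.BalabanUV.T4Continuum.CountSeamJunction Summit.QuantumFields.BalabanUV.T4Continuum.LateMergers
open Summit.QuantumFields.BalabanUV.T4Continuum.HistoryFlow Summit.QuantumFields.BalabanUV.T4Continuum.HistoryRegeneration
open Summit.QuantumFields.BalabanUV.T4Continuum.HistoryTables Summit.QuantumFields.BalabanUV.T4Continuum.HistoryAssemblyTrees
open Summit.QuantumFields.BalabanUV.T4Continuum.HistoryAssemblyTerms Summit.QuantumFields.BalabanUV.T4Continuum.HistoryAssemblyPedigree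
open Summit.QuantumFields.BalabanUV.T4Continuum.HistoryConstants Summit.QuantumFields.BalabanUV.T4Continuum.HistoryGen
open Literature.MathematicalPhysics.QuantumFieldTheory.Balaban1983to89.B13ScaleTransfer
open Summit.QuantumFields.BalabanUV.T4Continuum.ZoneSkeleton Summit.QuantumFields.BalabanUV.T4Continuum.HistorySocketTH
open Summit.QuantumFields.BalabanUV.T4Continuum.HistoryCaps Summit.QuantumFields.BalabanUV.T4Continuum.HistoryAssemblyPrice
open Summit.QuantumFields.BalabanUV.T4Continuum.HistoryBankingLE Summit.QuantumFields.BalabanUV.T4Continuum.HistoryExitLE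
open Summit.QuantumFields.BalabanUV.T4Continuum.HistoryAssemblyTreesLE Summit.QuantumFields.BalabanUV.T4Continuum.HistoryAssemblyTermsLE
open Summit.QuantumFields.BalabanUV.T4Continuum.HistoryRealise Summit.QuantumFields.BalabanUV.T4Continuum.HistoryAssemblyRealiseLE
open Summit.QuantumFields.BalabanUV.T4Continuum.HistoryAssemblyMult Summit.QuantumFields.BalabanUV.T4Continuum.HistoryAssemblyMultKey
open Summit.QuantumFields.BalabanUV.T4Continuum.HistoryAssemblyRealiseRun Summit.QuantumFields.BalabanUV.T4Continuum.HistoryAssemblyRealiseMult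
open Summit.QuantumFields.BalabanUV.T4Continuum.HistoryZones Summit.QuantumFields.BalabanUV.T4Continuum.HistoryRealiseCells
open Summit.QuantumFields.BalabanUV.T4Continuum.HistoryRealiseCellsRun Summit.QuantumFields.BalabanUV.T4Continuum.HistoryAssemblyRealiseRunMult
open Summit.QuantumFields.BalabanUV.T4Continuum.HistoryRealiseCellsRunMult Summit.QuantumFields.BalabanUV.T4Continuum.HistoryAssemblyMultInstance
open Summit.QuantumFields.BalabanUV.T4Continuum.HistoryJoinsPlacedMember Summit.QuantumFields.BalabanUV.T4Continuum.PlacementSkeleton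
open Summit.QuantumFields.BalabanUV.T4Continuum.HistoryJoinsPlacedMult Summit.QuantumFields.BalabanUV.T4Continuum.HistoryRealiseDistinct
open Summit.QuantumFields.BalabanUV.T4Continuum.HistoryRegionTemplates Summit.QuantumFields.BalabanUV.T4Continuum.HistoryCaps
open Summit.QuantumFields.BalabanUV.T4Continuum.HistoryZoneEvolve (cth)
open Literature.MathematicalPhysics.QuantumFieldTheory.Balaban1983to89.B16SProfile (DropCtl)
open Summit.QuantumFields.BalabanUV.T4Continuum.HistoryRealiseCellsRunMultEnd Summit.QuantumFields.BalabanUV.T4Continuum.HistoryRealiseCellsRunMultEndD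
open Summit.QuantumFields.BalabanUV.T4Continuum.HistoryRealiseCellsRunPinnedT3b Summit.QuantumFields.BalabanUV.T4Continuum.HistoryHybridRescale
open Summit.QuantumFields.BalabanUV.T4Continuum.HistoryRealiseCellsRunApex (exists_const_schemeZ)
open Summit.QuantumFields.BalabanUV.T4Continuum.HistoryRealisePrint Summit.QuantumFields.BalabanUV.T4Continuum.HistoryRealiseWeak
open Summit.QuantumFields.BalabanUV.T4Continuum.HistoryRealisePrintReading Summit.QuantumFields.BalabanUV.T4Continuum.HistoryRealiseWeakReading
open Summit.QuantumFields.BalabanUV.T4Continuum.HistoryRealisePrintCells Summit.QuantumFields.BalabanUV.T4Continuum.HistoryRealiseWeakCells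
open Summit.QuantumFields.BalabanUV.T4Continuum.HistoryRealiseCellsRunApexT3b Summit.QuantumFields.BalabanUV.T4Continuum.HistoryRealiseCellsRunApexT3bW
open Summit.QuantumFields.BalabanUV.T4Continuum.HistoryRealiseCellsRunApexT3bWT Summit.QuantumFields.BalabanUV.T4Continuum.HistoryRealiseCellsRunPinnedT3bWT
open Summit.QuantumFields.BalabanUV.T4Continuum.HistoryRealiseCellsRunHeadlineT3bWT
open Summit.QuantumFields.BalabanUV.T4Continuum.HistoryRealiseCellsRunApexT3bWTV Summit.QuantumFields.BalabanUV.T4Continuum.HistoryBankingVolumePlug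
open Summit.QuantumFields.BalabanUV.T4Continuum.HistoryRealiseCellsRunApexT3bWTVS
open Summit.QuantumFields.BalabanUV.T4Continuum.HistoryGenealogyRealise Summit.QuantumFields.BalabanUV.T4Continuum.HistoryGenealogyInstantiate
open Summit.QuantumFields.BalabanUV.T4Continuum.B16HistoryIndexedRepr Summit.QuantumFields.BalabanUV.T4Continuum.B16HistoryIndexedTrunc
open Summit.QuantumFields.BalabanUV.T4Continuum.HistoryBankingDiscountCharge Summit.QuantumFields.BalabanUV.T4Continuum.HistoryBankingCreditRead
open Summit.QuantumFields.BalabanUV.T4Continuum.HistoryBankingFibreRoom Summit.QuantumFields.BalabanUV.T4Continuum.HistoryPriceKeys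
open Summit.QuantumFields.BalabanUV.T4Continuum.HistoryRealiseCellsRunSupplyWTVS Summit.QuantumFields.BalabanUV.T4Continuum.HistoryRealiseCellsRunSupplyKeysWTVS
open Summit.QuantumFields.BalabanUV.T4Continuum.HistoryRealiseCellsRunAssemblyWTVSData Summit.QuantumFields.BalabanUV.T4Continuum.HistoryRealiseCellsRunAssemblyWTVSDataL
open Summit.QuantumFields.BalabanUV.T4Continuum.HistoryBankingSharpShares (sBsharp ell)
open Summit.QuantumFields.BalabanUV.T4Continuum.HistoryBankingRoundingUnrounded (sRunr ApFlat)
open Summit.QuantumFields.BalabanUV.T4Continuum.HistoryBankingVolumeWindowLattice (uvolL)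
open Literature.MathematicalPhysics.QuantumFieldTheory.Balaban1983to89.TreeLength Literature.MathematicalPhysics.QuantumFieldTheory.Balaban1983to89.B16MergeGeometry
open Summit.QuantumFields.BalabanUV.T4Continuum.HistoryAdmissible Summit.QuantumFields.BalabanUV.T4Continuum.HistoryGenealogyExtraction
open Summit.QuantumFields.BalabanUV.T4Continuum.HistoryGenealogyPedigree Summit.QuantumFields.BalabanUV.T4Continuum.HistoryTouchComponents
open Summit.QuantumFields.BalabanUV.T4Continuum.B16HistoryReprChain Summit.QuantumFields.BalabanUV.T4Continuum.B16HistoryReprInstance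
open Summit.QuantumFields.BalabanUV.T4Continuum.B16HistoryReprRead Summit.QuantumFields.BalabanUV.T4Continuum.B16HistoryReprReadCausal
open Summit.QuantumFields.BalabanUV.T4Continuum.B16HistoryStepDisplayPinned
open Summit.QuantumFields.BalabanUV.T4Continuum.B16HistoryTowerEndDataLWL
open Literature.MathematicalPhysics.QuantumFieldTheory.Balaban1983to89.B16StepFactorsPrinted
open Literature.MathematicalPhysics.QuantumFieldTheory.Balaban1983to89.B16LargeFieldFactors380 (minConst)
open Summit.QuantumFields.BalabanUV.T4Continuum.B16HistoryStepJunction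
open Summit.QuantumFields.BalabanUV.T4Continuum.B16HistoryTowerEndDataLWR
open Summit.QuantumFields.BalabanUV.T4Continuum.B16HistoryTowerEndPrinted
open Summit.QuantumFields.BalabanUV.T4Continuum.HistoryBankingSharpShares (ell)
open Summit.QuantumFields.BalabanUV.T4Continuum.B16HistoryTowerEndPrintedR
open Summit.QuantumFields.BalabanUV.T4Continuum.B16HistoryTowerEndPrintedRRange

namespace Summit.QuantumFields.BalabanUV.T4Continuum.B16HistoryTowerStepRangeDataLWR

noncomputable section

set_option synthInstance.maxSize 1024

/-! ## §1 The record -/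

section Data

variable {F : T4Family} {G : Type*} [GaugeGroup G] [MeasurableSpace G] [HaarData G] [RegularGaugeGroup G]

/-- **THE INPUTS OF THE (α) ASSEMBLY UNDER THE HEADLINE's OWN PREFIX, BOTH RUNS FROM ONE TOWER FAMILY, RENEWAL LETTER ROUNDED, IN PRINT's
PER-STEP SHAPE ON THE PERFORMED RANGE** (HYPOTHESIS SHAPE — data + located displays + C-side letters, NOTHING of Bałaban's asserted):
`TowerStepDataLWR` with (Δ1) print's per-step sentences, the class junction and p. 380's chain asked only at the performed steps `j < K`
(+ the padding display `hβ`, `hℓ1`, the chain constants) and (Δ2) run B read as the family's cutoff-`(K+1)` tower (`RB ρB holdsB intB H2B`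
and the parameters `I′ Y νB 𝒢′` gone; the truncation and the TRUNC ∕ (ρ′) ∕ NE7c ∕ NE7 rows typed over `skelFam T p₀`, `μ`, `reprFam …`);
every other field verbatim. [folklore] -/
structure TowerStepRangeDataLWR (D : FiniteEpsData F G) (C : T4PrintedShapeBanking.Consts) (O : PrintedO1s) (θv : ℝ)
    (rr d n : ℕ) (hn : 0 < n) (g₀ : ℕ → ℝ) (os : List (ULoop F))
    (cΛ M Φ β₀ : ℝ) (p₁ η η' κ κ₂ κᵥ : ℕ)
    (P : Type) [DecidableEq P] (X : ℕ → ℕ → Type) (𝒢 : (K j : ℕ) → GoodClass (X K j))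
    [∀ K, MeasurableSpace (X K K)] (μ : (K : ℕ) → Measure (X K K)) [∀ K, IsFiniteMeasure (μ K)] where
  /-- the source radius -/
  l₀ : ℝ
  /-- the volume factor of the matching remainders -/
  vol : ℝ
  /-- the source radius is positive -/
  l₀_pos : 0 < l₀
  /-- the volume factor is positive -/
  vol_pos : 0 < vol
  /-- the threshold in the number of steps -/
  K₀ : ℕ
  /-- THE TOWER of run A: per cutoff `K`, `K` one-step positive operations branching over the choices (IR-97-2) -/
  T : (K : ℕ) → Tower P (X K) (𝒢 K)
  /-- the small-field choice at every step of every run -/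
  p₀ : ℕ → ℕ → P
  /-- the small-field choice lies on every branch -/
  hp₀ : ∀ K j g, p₀ K j ∈ (T K).branch j g
  /-- the dressed initial densities `ρ₀ K t` (H2's `e^{t·obs}·ρ₀`) -/
  ρ₀ : (K : ℕ) → ℝ → X K 0 → ℝ
  /-- the dressed initial densities are good -/
  hρ₀ : ∀ K t, (𝒢 K 0).Gd (ρ₀ K t)
  /-- the dressed initial densities are non-negative -/
  h0 : ∀ K t x, 0 ≤ ρ₀ K t x
  /-- the sup letters of the dressed initial densities -/
  B : ℕ → ℝ → ℝ
  /-- the sup letters are positive -/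
  hB : ∀ K t, 0 < B K t
  /-- display: the dressed initial density is bounded by its letter on the window -/
  hBρ : ∀ K t, |t| ≤ l₀ → K₀ ≤ K → ∀ y, |ρ₀ K t y| ≤ B K t
  /-- display (integrability of the elementary terms of the tower's operations) -/
  intA : ∀ K t a, ∀ ι ∈ (skelFam T p₀ K).LIdx a, Integrable ((reprFam T p₀ ρ₀ hρ₀ h0 B hB K t).eterm a ι) (μ K)
  /-- display (H2: the dressed push-forward identity, at the tower's final density `densFam`) -/
  H2A : ∀ K t, |t| ≤ l₀ → K₀ ≤ K →
    ∫ U, Real.exp (t * T4GenFunBounds.prodObs (D.scheme g₀) K os U) * D.dens K (g₀ K) 0 U ∂fieldMeasure (F.P K) 0 G =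
      ∫ x, densFam T ρ₀ K t x ∂μ K
  /-- THE STEP READING of the tower's choices (regions, cubes, classes; flow, memory — IR-99-3) -/
  𝒮 : StepReading P d
  /-- (c1) the reading's blocking parameter is the family's -/
  hL : 𝒮.L = F.L
  /-- (c1) the reading's exponent profile is the run's own -/
  hs : 𝒮.s = runProfile F.L 𝒮.R
  /-- the small-field choice names no region -/
  hν0 : ∀ K j g, 𝒮.ν K j g (p₀ K j) = ∅
  /-- named regions are pointed, face-connected and of tree length at most their class -/
  hν : ∀ K j g p, ∀ nr ∈ 𝒮.ν K j g p, nr.1 ∈ nr.2 ∧ FaceConnected nr.2 ∧ treeLen nr.2 ≤ 𝒮.κ K nr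
  /-- flow: memory domination -/
  hRm : ∀ K s k, 𝒮.Rm K s k ≤ 𝒮.R K s
  /-- flow: memory domination, one-step form -/
  hRmS : ∀ K, K₀ ≤ K → ∀ t k, 𝒮.Rm K t (k + 1) ≤ 𝒮.R K (t + 1)
  /-- flow: non-degenerate memory -/
  hRm2 : ∀ K, K₀ ≤ K → ∀ t, 2 ≤ 𝒮.Rm K t 1
  /-- PRINT-SIDE STEP DATA: print's constants record ([B16] pp. 380–383's O(1)s, `B16StepFactorsPrinted.Consts`) -/
  c : B16StepFactorsPrinted.Consts
  /-- PRINT-SIDE STEP DATA: print's abstract per-step carriers (J4-a `StepData`) per run `K`, step `j`, prefix `g` -/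
  Xs : (K j : ℕ) → (Fin j → P) → StepData d P
  /-- C-side (3R-range): print's p. 380 chain constants are non-negative and within the volume letter's constant -/
  (hC' : 0 ≤ c.C') (hC380 : 0 ≤ c.C380) (hcΛc : c.C' + c.C380 ≤ cΛ)
  /-- flow (3R-range): `1 ≤ ℓ_{j+1}` on the performed range (couplings at most `e^{-1/2}`) -/
  hℓ1 : ∀ K, K₀ ≤ K → ∀ j, j < K → 1 ≤ ell (gsOf D g₀ K) (j + 1)
  /-- tower-side display (β) (J4.2's `hβ`): PAST THE CUTOFF the step maps kill the unit — the natural padding of a `K`-step run -/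
  hβ : ∀ K, K₀ ≤ K → ∀ j, K ≤ j → ∀ (g : Fin j → P) (p : P) (x : X K (j + 1)), ((T K).op j g p).T (fun _ => 1) x = 0
  /-- display: PRINT's PER-STEP SENTENCES `StepDisplaysAt` (IR-100-2, all five conjuncts — the ROUNDED (P) included) AT THE CARRIERS
  READ OFF THE TOWER AND THE PROCESS (`carriersOf`), every run `K ≥ K₀`, PERFORMED step `j < K`, prefix `g` — J4.2's binder verbatim -/
  hdisp : ∀ K, K₀ ≤ K → ∀ j, j < K → ∀ (g : Fin j → P),
    StepDisplaysAt (runsOf D g₀ K) j (carriersOf T 𝒮 (runsOf D g₀ K) K j g (Xs K j g)) c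
  /-- display: the `=` CLASS JUNCTION on the performed range (J4.2's `hclass`) -/
  hclass : ∀ K, K₀ ≤ K → ∀ j, j < K → ∀ (g : Fin j → P) (p : P),
    ∀ x ∈ (𝒮.runPartial K (j + 1) (Fin.snoc g p)).histM.newPairs (j + 1),
      (Xs K j g).dC p x = (𝒮.κ K ((𝒮.runPartial K (j + 1) (Fin.snoc g p)).histM.newAt (j + 1) x) : ℝ)
  /-- display: p. 380's chain, FIRST LINK — the region volume is at most the large-field volume (3R-range's `hΩ`) -/
  hΩ : ∀ K, K₀ ≤ K → ∀ j, j < K → ∀ (g : Fin j → P) (p : P), (Xs K j g).volZΩ p ≤ (Xs K j g).volZ p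
  /-- display: p. 380's chain in CUBE-COUNT form — the large-field volume is at most `(M·R_{j+1})^d` per component cube (3R-range's `hcube`) -/
  hcube : ∀ K, K₀ ≤ K → ∀ j, j < K → ∀ (g : Fin j → P) (p : P),
    (Xs K j g).volZ p ≤
      (M * 𝒮.R K (j + 1)) ^ d * ∑ cc ∈ (𝒮.runPartial K (j + 1) (Fin.snoc g p)).histM.comp (j + 1), ((cc.2).card : ℝ)
  /-- letter table (3R): print's constants record carries the cell's dimension -/
  hd : c.d = O.d
  /-- letter table (3R, (2.5)): print's size profile AT the run's couplings IS the reading's sizes -/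
  hR : ∀ K h, c.R (gsOf D g₀ K h) = (𝒮.R K h : ℝ)
  /-- letter table (3R): print's `p₁`-profile is `ℓ^{p₁}` -/
  hP : ∀ K h, c.P1 (gsOf D g₀ K h) = ell (gsOf D g₀ K) h ^ p₁
  /-- display (2.5): the reading's sizes are admissible for the running couplings -/
  isRj : ∀ K s, s ≤ K → B14.IsRj F.L rr ((D.C ⟨K, F.m, g₀ K⟩).flow.g s) (𝒮.R K s)
  /-- sizes are at least one -/
  one_le_R : ∀ K, K₀ ≤ K → ∀ t, 1 ≤ 𝒮.R K t
  /-- flow (K): the blocking parameter is at least four -/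
  hL4 : 4 ≤ F.L
  /-- flow (K): the run's own exponent profile is non-increasing within the run -/
  hprof : ∀ K, K₀ ≤ K → ∀ t, t < K → runProfile F.L 𝒮.R K (t + 1) ≤ runProfile F.L 𝒮.R K t
  /-- flow (K): drop control of the run's own profile -/
  hdrop : ∀ K, K₀ ≤ K → ∀ m, DropCtl (runProfile F.L 𝒮.R K) m
  /-- pass-V input condition per term: disjoint new regions -/
  hD : ∀ K, K₀ ≤ K → ∀ τ ∈ HIndex.termSet (skelFam T p₀) K, ((𝒮.reading T p₀).inputOf.run K τ).NewDisjoint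
  /-- pass-V input condition per term: every new region lies in the torus' period box at its level -/
  hreg : ∀ K, K₀ ≤ K → ∀ τ ∈ HIndex.termSet (skelFam T p₀) K, ((𝒮.reading T p₀).inputOf.run K τ).RegionsInBox n K
  /-- constants: the window constant -/
  hn₁ : 13 ≤ C.n₁
  /-- constants -/
  hE₂ : 0 < C.E₂
  /-- constants — `E₃` strictly positive -/
  hE₃pos : 0 < C.E₃
  /-- fibre shares, births -/
  φB : ℕ → ℕ → ℕ → ℝ
  /-- fibre shares, renewals -/
  φR : ℕ → ℕ → ℝ
  /-- (2.9)∕(2.7)'s letter `β′` -/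
  β' : ℝ
  /-- display (2.9) on the reading's sizes -/
  h29 : ∀ K, K₀ ≤ K → B14FlowStep.FlowIneq29 (𝒮.R K) (D.C ⟨K, F.m, g₀ K⟩).flow.g F.L β' β₀ K
  /-- the term-free curly normalisation envelope -/
  W : ℕ → ℝ
  /-- display -/
  one_le_W : ∀ K, 1 ≤ W K
  /-- the term-free envelopes' K-uniform bounds -/
  (Wi BAi mi : ℝ)
  /-- display -/
  hWi : ∀ K, W K ≤ Wi
  /-- display: the sup letters' logarithms are K-uniformly bounded on the window (the pinned bundle's `BA K t = log (B K t)`) -/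
  hBA : ∀ K t, |t| ≤ l₀ → K₀ ≤ K → Real.log (B K t) ≤ BAi
  /-- display -/
  hmi : ∀ K, (μ K).real Set.univ ≤ mi
  /-- C-side: print's p. 380 volume constant is nonnegative -/
  hcΛ : 0 ≤ cΛ
  /-- C-side: the cube-side letter `M` of the lattice volume letter is nonnegative -/
  hMΛ : 0 ≤ M
  /-- flow (ADDED): `0 ≤ ℓ_j = log (g^K_j)⁻²` on every run's performed range (couplings at most one) -/
  hℓ : ∀ K j, j ≤ K → 0 ≤ ell (gsOf D g₀ K) j
  /-- display (ρ) `FibreMass` (located, VOLUME type), at the tower's reading and pinned bundle -/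
  hρ : ∀ K t, |t| ≤ l₀ → K₀ ≤ K →
    ∀ k ∈ badGMems (memA n F.L (𝒮.reading T p₀)) jhalf (HIndex.termSet (skelFam T p₀))
        (kmemA n F.L hn (lt_of_lt_of_le (by norm_num) (two_le_L F)) (𝒮.reading T p₀)) K,
      ∑ τ ∈ fibre (kmemA n F.L hn (lt_of_lt_of_le (by norm_num) (two_le_L F)) (𝒮.reading T p₀))
          (HIndex.termSet (skelFam T p₀)) K k,
        dmassOf (𝒮.reading T p₀)
            (factorsPinned T p₀ 𝒮 B (B16HistoryStepJunction.sBsharp (runsOf D g₀) c) (sRrnd D O p₁ g₀ 𝒮.R) cΛ M (gsOf D g₀) hcΛ hMΛ hℓ) t τ ≤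
          W K * MULTOf (sharpT (φB K) (φR K)) k
  /-- the (γ) small-field mass floor -/
  c₀ : ℝ
  /-- the site budget -/
  n₁ : ℝ
  /-- the floor is positive -/
  c₀_pos : 0 < c₀
  /-- (γ) floor, run A -/
  floor : ∀ K, K₀ ≤ K → c₀ ≤ smallFieldMass D K (g₀ K)
  /-- (γ) floor, run B -/
  floor' : ∀ K, K₀ ≤ K → c₀ ≤ smallFieldMass D (K + 1) (g₀ (K + 1))
  /-- site budget, run A -/
  sites : ∀ K, K₀ ≤ K → ((D.C ⟨K, F.m, g₀ K⟩).numSites K : ℝ) ≤ n₁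
  /-- site budget, run B -/
  sites' : ∀ K, K₀ ≤ K → ((D.C ⟨K + 1, F.m, g₀ (K + 1)⟩).numSites (K + 1) : ℝ) ≤ n₁
  /-- RUN B = THE SAME FAMILY AT CUTOFF `K + 1` (S, NODE O): the truncation of the cutoff-`(K+1)` tower's level-`(K+1)` terms onto
  the cutoff-`K` tower's index -/
  trunc : ℕ → HIndex.Idx (skelFam T p₀) → HIndex.Idx (skelFam T p₀)
  /-- display (S): the truncation maps run B's term set into run A's -/
  htr : ∀ K, K₀ ≤ K → ∀ τ' ∈ HIndex.termSet (skelFam T p₀) (K + 1), trunc K τ' ∈ HIndex.termSet (skelFam T p₀) K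
  /-- RUN B: per-term dead weights -/
  dB : ℕ → ℝ → HIndex.Idx (skelFam T p₀) → ℝ
  /-- RUN B: envelope -/
  mup : ℕ → ℝ → ℝ
  /-- RUN B: sharp ∕ share letters of run B -/
  (sB' φB' : ℕ → ℕ → ℕ → ℝ)
  /-- RUN B: share letters of run B, renewals -/
  φR' : ℕ → ℕ → ℝ
  /-- display (R «TRUNC»): run B's numerator reading per term, KEYED AT RUN A's KEYS -/
  upB : ∀ K t, |t| ≤ l₀ → K₀ ≤ K →
    ∀ k ∈ badGMems (memA n F.L (𝒮.reading T p₀)) jhalf (HIndex.termSet (skelFam T p₀))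
        (kmemA n F.L hn (lt_of_lt_of_le (by norm_num) (two_le_L F)) (𝒮.reading T p₀)) K,
      ∀ τ' ∈ HIndex.termSet (skelFam T p₀) (K + 1),
        trunc K τ' ∈ fibre (kmemA n F.L hn (lt_of_lt_of_le (by norm_num) (two_le_L F)) (𝒮.reading T p₀))
            (HIndex.termSet (skelFam T p₀)) K k →
          Repr172R.weight μ (reprFam T p₀ ρ₀ hρ₀ h0 B hB) t τ' ≤
            dB K t τ' * LIVEOf C K (𝒮.R K) (fun m => 2 ^ (d + 3) *
                Real.log ((factorsPinned T p₀ 𝒮 B (B16HistoryStepJunction.sBsharp (runsOf D g₀) c) (sRrnd D O p₁ g₀ 𝒮.R) cΛ M (gsOf D g₀) hcΛ hMΛ hℓ).Λ K m))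
              (sharpT (sB' K) (sRrnd D O p₁ g₀ 𝒮.R K)) k * mup K t
  /-- display (R «TRUNC»): run B's dead weights are nonnegative over the composite fibres -/
  deadB_nonneg : ∀ K t, |t| ≤ l₀ → K₀ ≤ K →
    ∀ k ∈ badGMems (memA n F.L (𝒮.reading T p₀)) jhalf (HIndex.termSet (skelFam T p₀))
        (kmemA n F.L hn (lt_of_lt_of_le (by norm_num) (two_le_L F)) (𝒮.reading T p₀)) K,
      ∀ τ' ∈ HIndex.termSet (skelFam T p₀) (K + 1),
        trunc K τ' ∈ fibre (kmemA n F.L hn (lt_of_lt_of_le (by norm_num) (two_le_L F)) (𝒮.reading T p₀))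
            (HIndex.termSet (skelFam T p₀)) K k →
          0 ≤ dB K t τ'
  /-- display (ρ′) (located, VOLUME type): run B's fibre mass over the COMPOSITE fibre of a key -/
  resumB : ∀ K t, |t| ≤ l₀ → K₀ ≤ K →
    ∀ k ∈ badGMems (memA n F.L (𝒮.reading T p₀)) jhalf (HIndex.termSet (skelFam T p₀))
        (kmemA n F.L hn (lt_of_lt_of_le (by norm_num) (two_le_L F)) (𝒮.reading T p₀)) K,
      ∑ τ' ∈ (HIndex.termSet (skelFam T p₀) (K + 1)).filter (fun τ' =>
          trunc K τ' ∈ fibre (kmemA n F.L hn (lt_of_lt_of_le (by norm_num) (two_le_L F)) (𝒮.reading T p₀))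
            (HIndex.termSet (skelFam T p₀)) K k),
        dB K t τ' ≤ MULTOf (sharpT (φB' K) (φR' K)) k
  /-- display: run B's envelope bound (at `Nup := e^{BA∞}·m∞·W∞`) -/
  mup_bd : ∀ K t, |t| ≤ l₀ → K₀ ≤ K → 0 ≤ mup K t ∧ mup K t ≤ Real.exp BAi * mi * Wi
  /-- NE7c: the two runs' shell parts -/
  (shA shB : ℕ → ℝ → HIndex.Idx (skelFam T p₀) → ℝ)
  /-- NE7c's shell weight budget -/
  Wsh : ℕ → ℝ
  /-- NE7c (S): the indicator shells' relative weight bound over the tower's terms -/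
  shell : ShellWeightBound l₀ (HIndex.termSet (skelFam T p₀))
    (fun _ t => Repr172R.weight μ (reprFam T p₀ ρ₀ hρ₀ h0 B hB) t)
    (weightB μ (reprFam T p₀ ρ₀ hρ₀ h0 B hB) trunc) shA shB Wsh
  /-- NE7 core budget data -/
  (Cc Rr CcRec RrRec : ℕ → ℝ → HIndex.Idx (skelFam T p₀) → ℝ)
  /-- NE7 core budget rates -/
  (ν u s₂ q₀ r s : ℕ → ℝ)
  /-- NE7 (S): the re-indexed per-term budget over the tower reading's bad classes -/
  budget : ReindexedBudget l₀ vol (HIndex.termSet (skelFam T p₀))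
    (fun K t τ => Repr172R.weight μ (reprFam T p₀ ρ₀ hρ₀ h0 B hB) t τ - shA K t τ)
    (fun K t τ => weightB μ (reprFam T p₀ ρ₀ hρ₀ h0 B hB) trunc K t τ - shB K t τ)
    (badOfClass (bstrOf Prod.fst (memA n F.L (𝒮.reading T p₀))) (HIndex.termSet (skelFam T p₀))
      (fun K _ => badClasses Prod.fst (memA n F.L (𝒮.reading T p₀)) jhalf (HIndex.termSet (skelFam T p₀)) K))
    Cc Rr CcRec RrRec ν u s₂ q₀ r s
  /-- summable rates -/
  (sum_r : Summable r) (sum_u : Summable u) (sum_s : Summable s) (sum_s₂ : Summable s₂)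
  /-- C-side signs: the volume slack is positive; `β₀, Φ ≥ 0` -/
  (hθv : 0 < θv) (hβ₀ : 0 ≤ β₀) (hΦ : 0 ≤ Φ)
  /-- C-side: the birth-floor mass letter -/
  m : ℝ
  /-- C-side: `A₁² ≤ m` -/
  hm : O.A₁ ^ 2 ≤ m
  /-- census identity AT PRINT's `t = d+5` ([B16] p. 383 «we assume that 2p₁ − (d+5)r₀ > p₀», the gap named `η`) -/
  hexpR : C.p₀ + rr * (O.d + 5) + η = 2 * p₁
  /-- census identity: `r(q′+1) + r(d+5) + η′ = 2p₁` -/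
  hexpR' : rr * (C.q' + 1) + rr * (O.d + 5) + η' = 2 * p₁
  /-- census identity: `r(q′+1) + κ = 2p₀` -/
  hexpB : rr * (C.q' + 1) + κ = 2 * C.p₀
  /-- census identity in LATTICE units: `1 + κ₂ = r·(q′ − d)` -/
  hexpFL : 1 + κ₂ = rr * (C.q' - d)
  /-- census side condition in LATTICE units: `d ≤ q′` -/
  hdq : d ≤ C.q'
  /-- census identity in LATTICE units: `1 + r·d + κᵥ = 2p₀` -/
  hexpVL : 1 + rr * d + κᵥ = 2 * C.p₀
  /-- exponent gaps -/
  (hη : 1 ≤ η) (hη' : 1 ≤ η') (hκ : 1 ≤ κ) (hκ₂ : 1 ≤ κ₂) (hκᵥ : 1 ≤ κᵥ)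
  /-- constants: `1 ≤ p₀` -/
  hp₀c : 1 ≤ C.p₀
  /-- signs of print's O(1)s -/
  (hγ₀ : 0 < O.γ₀) (hA₁ : O.A₁ ≠ 0) (hA₀ : 0 < C.A₀) (hM : 0 < O.M)
  /-- φ-BUDGET, births, run A -/
  hφB : ∀ K j d', φB K j d' ≤ Φ * dshare C F.L (𝒮.R K) ((j, 0, d') : PEv)
  /-- φ-BUDGET, renewals, run A -/
  hφR : ∀ K h, φR K h ≤ Φ * dshare C F.L (𝒮.R K) ((h + 1, 1, 0) : PEv)
  /-- φ-BUDGET, births, run B's letters -/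
  hφB' : ∀ K j d', φB' K j d' ≤ Φ * dshare C F.L (𝒮.R K) ((j, 0, d') : PEv)
  /-- φ-BUDGET, renewals, run B's letters -/
  hφR' : ∀ K h, φR' K h ≤ Φ * dshare C F.L (𝒮.R K) ((h + 1, 1, 0) : PEv)
  /-- letter table (part 3 `hsB_of_tables`): print's `γ₀` is the count road's -/
  hγc : c.γ₀ = O.γ₀
  /-- letter table (part 3): print's `A₀` is the count road's -/
  hAc : c.A₀ = C.A₀
  /-- letter table (part 3): print's `p₀` is the count road's -/
  hpc : c.p₀ = C.p₀
  /-- letter table (part 3): the birth-floor mass letter is at most print's p. 381 min-constant `min{½B₃⁻²A₀², 2A₁², A₁²}` -/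
  hmc : m ≤ minConst c.B₃ c.A₀ c.A₁
  /-- BIRTH LETTER FLOOR, run B's letters -/
  hsB' : ∀ K j d', sBsharp O m C (D.C ⟨K, F.m, g₀ K⟩).flow.g j d' ≤ sB' K j d'
  /-- (2.7)'s power (NE7-rate row) -/
  p27 : ℕ
  /-- (2.7)'s power is at least one -/
  hp27 : 1 ≤ p27
  /-- display (2.7) per cutoff on the run's couplings -/
  h27 : ∀ K, K₀ ≤ K → B14.FlowIneq27 (D.C ⟨K, F.m, g₀ K⟩).flow.g β' β₀ p27 K

end Data

end

end Summit.QuantumFields.BalabanUV.T4Continuum.B16HistoryTowerStepRangeDataLWR
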